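import Summits.CriticalPhenomena.PercolationContinuityZ3.Theorems.Transplant.SkelPhiCorridorKGRoomsQT
import HarnessLib

/-!
((R-40) T PORT of `SkelPhiCorridorKGRoomsQD`: the cell layer `PCells2S` ↦ `PCells2T` (per-axis creep cap), names per hp-8 g42 renamedT/modmapT + stmt-g21 renamed_mine;
cell-free lemmas are NOT re-declared (imported from the S original). Text otherwise verbatim.)
# N2 (frames-only node `SamePDropOfSkeletonFrm₁`, OPEN), (C) column, J15 REPAIR: THE (C) RESIDUE AT THE STAGGERED SCHEME WITH THE ENTRANCE DEPTH AS A
# HYPOTHESIS — `Skelφ.reachOblAtHNF_of_kgCorrTD` (first axis)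

`reachOblAtHNF_of_kgCorrT` (SkelPhiCorridorKGRoomsQ, p352869) VERBATIM except that the explored-neighbour depth `hdeep` (the input of the rim-excess
device `real_rim_le_corrO`) is a HYPOTHESIS `∀ a ∈ Vx h, ∀ b ∈ Ω, b ∉ Vx h → a ~ b → a ∈ B_G(w₀, R₀)` instead of being derived from the radius rows
`hRC : rC α v ≤ R₀`, `hRB : rB α v δ' ≤ R₀` through `deep_of_valid₂OT` — J15 (lane INBOX 2026-08-23T05:27:27Z): with those rows `R₀ ≥ rB α v e.2 =
E(nQ α x) ≥ R + 1` at every realised probe of the schedule of record, while the device needs `R − r₀ ≥ R₁ ≥ R₀ + 1`, so the row set of the landed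
residue is unsatisfiable; the sharp depth `R₀ := E(nS α v)` comes from the oriented run-deep lemma (`deep_of_run₂bOT`, port of N1's `deep_of_run₂b`)
in the wrapper. The readers of §1 of SkelPhiCorridorKGRoomsQ are imported.
builds on p205010 (kernel theorem, internal audit signed; external expert review pending) — nothing in this file uses p205010; nothing here is a claim
about the open node `SamePDropOfSkeletonFrm₁`.
Lane `prim-bschramm`, seat `prim-bschramm-p5` (gen 16; (C) lineage); helper file (`--supports stmt-CriticalPhenomena-4575 --as helper`).
[cite: KozmaNitzan2024, §4 pp. 25–27 (Q_v, M_v, E_{v,x}, H_{v,x}), Lemma 12 (pp. 23–25), p. 30 (Step IV)] [cite: MartineauTassion2017, §4.3 Lemma 4.2]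
-/

noncomputable section

open MeasureTheory ProbabilityTheory
open scoped ENNReal Classical

namespace Summit.CriticalPhenomena.PercolationContinuityZ3.Theorems

namespace Transplant

namespace Skelφ

open Literature.Probability.Percolation Literature.Probability.LatticeModels SimpleGraph GadgetSystem ProbeHistory HSiteScheme Contour KNCells
open Literature.Probability.Percolation.KozmaNitzan.Cells (oth oth_ne sgOf sgOf_sign eq_oth_of_ne)
open KNCells.KSchA KNLevels ChainPlanar ChainPara
open Literature.Barriers.CriticalPhenomena (graphBall graphBall_mono)
open Skel (winGraph winGraphIn winGraphIn_le ReachOblAtHNF excess)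
open SkelI (tanOff)
open TwoAxis.Para (modulus)
open BoxProdZ2 (ConcRadiiG)

variable {V : Type} [DecidableEq V] [Countable V] {G : SimpleGraph V} [G.LocallyFinite] {φ : V → Site 2}

/-- **THE (C) RESIDUE AT ONE PROBE OF THE STAGGERED SCHEME, FIRST AXIS, Γ ROWS DISCHARGED, ENTRANCE DEPTH A HYPOTHESIS (J15)** (kit at the column
end, chain data built, excess/depth discharged — `reachOblAtHNF_of_kgCorrEC`; `hΩball/hreg/hM0/hlastM/hdeep/hRdepth` from reading rows through hp-8 g40's
rooms and the frame boxes of SkelPhiCorridorKGBoxes). [cite: KozmaNitzan2024, §4 Lemma 12 (pp. 23–25), p. 30 (Step IV)] -/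
theorem reachOblAtHNF_of_kgCorrTD
    -- the staggered scheme: fine map `ψ` (the fine skeleton map sharing the run frame's period and shear), cells `P`, centre `w₀`, radii `Λ`, box `b₀`
    {ψ : V → Site 2} {t₀ : V} {A vα vβ c₀' c₁' s₀ s₁ D : ℤ} {n ℓ : ℕ} {hs v : ℤ}
    (hψ : ψ = fineSkel φ t₀ A n hs vα vβ c₀' c₁' s₀ s₁ D) (hAp : 0 < A) (hmp : 0 < modulus n hs vα vβ) (hc₀p : 0 < c₀') (hc₁p : 0 < c₁') (hDp : 0 < D)
    (hlip : Lip G ψ) (hws : WeakSteps G ψ)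
    {P : PCells2T} {w₀ : V} {Λ : ConcRadiiG} {b₀ : Fin 2 → ℕ} (hb : ∀ i, b₀ i ≤ 3 * P.r i) {q : unitInterval} {δc : ℝ} {LD : LevelData V ℕ}
    (hL : LevelGeom G (cellGeomSG₂bT G ψ P w₀ Λ b₀) (faceDataSGT G ψ P w₀ Λ) LD)
    (hSt : StepsGeom (cellGeomSG₂bT G ψ P w₀ Λ b₀) (faceDataSGT G ψ P w₀ Λ)) (hEx : ExitGeom G (cellGeomSG₂bT G ψ P w₀ Λ b₀))
    -- the probe
    {h : ProbeHistory V} {e : Site 2 × MDir} (hV : (⟨cellGeomSG₂bT G ψ P w₀ Λ b₀, q, δc⟩ : KSchA V ℕ).Valid₂O G h e)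
    {du : MDir} (hdu : du ∈ (⟨cellGeomSG₂bT G ψ P w₀ Λ b₀, q, δc⟩ : KSchA V ℕ).onwardO G h (tgt e)) (hdu' : du ≠ rev e.2)
    -- the skeleton map, the frame (origin `c₀` = the column vertex of the cell `tgt e`: `ψ c₀ = cenS (tgt e)`)
    (hlipφ : Lip G φ) (hstep : Steps G φ) {Δ : ℕ} (hΔ : ∀ v, G.degree v ≤ Δ) (hn : 1 ≤ n) (c₀ : V) {kq : ℕ} (hκL : hs.natAbs ≤ kq * n)
    (hctr : ψ c₀ = PCells2T.cenS P (tgt e))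
    -- the corridor of record
    {R' ρ qq W N m₁ Wm₂ Wp₂ m₂ : ℕ}
    (hP₁ : ParkOK (kgPark₁ n ℓ hs v R' ρ qq W N m₁)) (hP₂ : ParkOK (kgPark₂ n ℓ hs v R' ρ qq W N m₁ Wm₂ Wp₂ m₂))
    (hsplit : (Wm₂ : ℤ) + Wp₂ = (kgPark₁ n ℓ hs v R' ρ qq W N m₁).aHi (m₁ + 1) - ParkPrm.aLo (kgPark₁ n ℓ hs v R' ρ qq W N m₁) (m₁ + 1))
    -- the window
    {R r Rl : ℕ} (hr : Rl ≤ r) (hrR : r ≤ R)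
    -- kit constants
    (Pk : ApronPrm) {Mz Rs KCmax rs cS cU : ℕ} (hPN : kq + 3 ≤ Pk.N) (hA : Pk.A = (Mz + 1 : ℕ) * (shearUnit n hs : ℤ) + 1)
    (hdD : Pk.d + 2 ≤ shellD Pk) (hDρ : Rs + 1 ≤ shellD Pk) (hKCmax : (shellD Pk + Mz + 1) * (kq + 1) ≤ KCmax)
    (hT : (shellD Pk : ℤ) + KCmax + Rs ≤ tanOff Pk.ℓs Pk.M)
    (hr₀ : Pk.N * (tanOff Pk.ℓs Pk.M + 2) + Pk.N * Pk.d + (KCmax + Rs) ≤ Pk.r₀) (hR : Pk.r₀ ≤ R) (hr₀1 : 1 ≤ Pk.r₀)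
    (hrs : 1 + (Pk.N * (tanOff Pk.ℓs Pk.M + 2) + Pk.N * Pk.d + (KCmax + Rs)) ≤ rs)
    (hcS : (Pk.N + 1) * (tanOff Pk.ℓs Pk.M + 1) + (Pk.N + 1) * Pk.d + (KCmax + 1) + cU ≤ cS)
    (hreach : r + (Pk.N * (tanOff Pk.ℓs Pk.M + 1) + Pk.N * Pk.d + KCmax) ≤ Pk.r₀)
    -- the short region and the zone datum
    (Rg : V → Finset V) (hRg : ∀ c, ∀ u ∈ Rg c, u ∈ graphBall G c Rs) (hRgcard : ∀ c, (Rg c).card ≤ cU) (hcU1 : 1 ≤ cU)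
    (Λc : V → ℕ → Finset V) (kz : ℕ) (hΛRg : ∀ c, Λc c kz ⊆ Rg c) (hzconn : ∀ c, ∀ s ∈ Λc c kz, PathIn G (↑(Λc c kz) : Set V) c s)
    (hcz : ∀ c, c ∈ Λc c kz)
    -- the chain's level data
    {Rlev Nk j₀ j₁ : ℕ} (hj0 : tanOff Pk.ℓs Pk.M ≤ j₀) (hj : j₁ ≤ Rlev) (hRl : Rlev + 1 ≤ R')
    (hE : j₁ + (Pk.N * (tanOff Pk.ℓs Pk.M + 1) + Pk.N * Pk.d + KCmax) ≤ R')
    {Δ' : ℕ} {δ η : ℝ} (hδ : 0 < δ) (hη : η ≤ δ / 2)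
    (kk : ℕ) (hN : kk * (Δ + 1) ^ (2 * rs) ≤ Nk) (hk : (1 - (q : ℝ) ^ (1 + Δ * cS + cS * cU)) ^ kk ≤ δ)
    (hcount : 1 / (1 - (q : ℝ)) ^ (Δ' * Nk) ≤ δ * ((Finset.Icc j₀ j₁).card : ℝ))
    -- RADIUS ROWS of the Γ rooms (habitat windows hold the corridor window; the stub staircase feeds the arrival cube; the source's windows for `hdeep`)
    (hDQ : R + 1 ≤ Λ.rQ ((⟨cellGeomSG₂bT G ψ P w₀ Λ b₀, q, δc⟩ : KSchA V ℕ).aOf₁O G h e) (tgt e))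
    (hDρ' : ∀ l, R + 1 ≤ Λ.ρ ((⟨cellGeomSG₂bT G ψ P w₀ Λ b₀, q, δc⟩ : KSchA V ℕ).aOf₂O G h e) (tgt e) du l)
    (hρM : ∀ l, Λ.ρ ((⟨cellGeomSG₂bT G ψ P w₀ Λ b₀, q, δc⟩ : KSchA V ℕ).aOf₂O G h e) (tgt e) du l + 1 ≤
      Λ.rM ((⟨cellGeomSG₂bT G ψ P w₀ Λ b₀, q, δc⟩ : KSchA V ℕ).aOf₂O G h e) (tgt e + stepVec du))
    -- THE ENTRANCE DEPTH (J15): explored neighbours of the fresh habitat lie in `B_G(w₀, R₀)` (the wrapper: `deep_of_run₂bOT`, `R₀ := E(nS α v)`)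
    {R₀ : ℕ} (hdeep : ∀ a ∈ (⟨cellGeomSG₂bT G ψ P w₀ Λ b₀, q, δc⟩ : KSchA V ℕ).Vx G h,
      ∀ b ∈ (cellGeomSG₂bT G ψ P w₀ Λ b₀).Ewv ((⟨cellGeomSG₂bT G ψ P w₀ Λ b₀, q, δc⟩ : KSchA V ℕ).aOf₁O G h e) e.1 e.2 ∪
        (faceDataSGT G ψ P w₀ Λ).Hfull ((⟨cellGeomSG₂bT G ψ P w₀ Λ b₀, q, δc⟩ : KSchA V ℕ).aOf₂O G h e) (tgt e) du,
      b ∉ (⟨cellGeomSG₂bT G ψ P w₀ Λ b₀, q, δc⟩ : KSchA V ℕ).Vx G h → G.Adj a b → a ∈ graphBall G w₀ R₀)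
    -- READING ROWS of the prism box `[(−Z₀, −Z₁), ((N+1)n + Z₀, Z₁)]` (margins of `mem_habΩT_of_footprint`)
    (hPl : -(5 * (P.r du.1 : ℤ)) + 1 ≤ rdLo A n hs vα vβ c₀' c₁' D (![-kgZ₀ n v R' ρ qq N m₁ m₂, -kgZ₁ n ℓ hs R' ρ W N m₁ Wm₂ Wp₂ m₂])
        (![((N : ℤ) + 1) * n + kgZ₀ n v R' ρ qq N m₁ m₂, kgZ₁ n ℓ hs R' ρ W N m₁ Wm₂ Wp₂ m₂]) du.1 ∧
      rdHi A n hs vα vβ c₀' c₁' D (![-kgZ₀ n v R' ρ qq N m₁ m₂, -kgZ₁ n ℓ hs R' ρ W N m₁ Wm₂ Wp₂ m₂])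
        (![((N : ℤ) + 1) * n + kgZ₀ n v R' ρ qq N m₁ m₂, kgZ₁ n ℓ hs R' ρ W N m₁ Wm₂ Wp₂ m₂]) du.1 ≤ 22 * (P.r du.1 : ℤ) - 1)
    (hPt : -(2 * (P.r (oth du.1) : ℤ)) + 1 ≤ rdLo A n hs vα vβ c₀' c₁' D (![-kgZ₀ n v R' ρ qq N m₁ m₂, -kgZ₁ n ℓ hs R' ρ W N m₁ Wm₂ Wp₂ m₂])
        (![((N : ℤ) + 1) * n + kgZ₀ n v R' ρ qq N m₁ m₂, kgZ₁ n ℓ hs R' ρ W N m₁ Wm₂ Wp₂ m₂]) (oth du.1) ∧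
      rdHi A n hs vα vβ c₀' c₁' D (![-kgZ₀ n v R' ρ qq N m₁ m₂, -kgZ₁ n ℓ hs R' ρ W N m₁ Wm₂ Wp₂ m₂])
        (![((N : ℤ) + 1) * n + kgZ₀ n v R' ρ qq N m₁ m₂, kgZ₁ n ℓ hs R' ρ W N m₁ Wm₂ Wp₂ m₂]) (oth du.1) ≤ 2 * (P.r (oth du.1) : ℤ) - 1)
    -- READING ROWS of the arrival box (any frame box `[llo, lhi]` holding the last core; at the values it is SkelPhiCorridorKGBoxes' `kgLastLo/Hi`)
    {llo lhi : Site 2} (hlast : ScheduleNP.core (kgCorrSched hP₁ hP₂ hsplit) ((kgCorrSched hP₁ hP₂ hsplit).N + 1) ⊆ Finset.Icc llo lhi)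
    (hLl : 20 * (P.r du.1 : ℤ) - b₀ du.1 + 1 ≤ rdLo A n hs vα vβ c₀' c₁' D llo lhi du.1 ∧ 5 * (P.r du.1 : ℤ) ≤ rdLo A n hs vα vβ c₀' c₁' D llo lhi du.1 ∧
      rdHi A n hs vα vβ c₀' c₁' D llo lhi du.1 ≤ 20 * (P.r du.1 : ℤ) + b₀ du.1 - 1 ∧ rdHi A n hs vα vβ c₀' c₁' D llo lhi du.1 ≤ 22 * (P.r du.1 : ℤ))
    (hLt : PCells2T.cenS P (tgt e + stepVec du) (oth du.1) - PCells2T.cenS P (tgt e) (oth du.1) - b₀ (oth du.1) + 1 ≤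
        rdLo A n hs vα vβ c₀' c₁' D llo lhi (oth du.1) ∧
      rdHi A n hs vα vβ c₀' c₁' D llo lhi (oth du.1) ≤
        PCells2T.cenS P (tgt e + stepVec du) (oth du.1) - PCells2T.cenS P (tgt e) (oth du.1) + b₀ (oth du.1) - 1 ∧
      -(2 * (P.r (oth du.1) : ℤ)) ≤ rdLo A n hs vα vβ c₀' c₁' D llo lhi (oth du.1) ∧ rdHi A n hs vα vβ c₀' c₁' D llo lhi (oth du.1) ≤ 2 * (P.r (oth du.1) : ℤ))
    -- START-BOX ROWS (the source cube's fine footprint `cenS (tgt e) ± b₀` read back into the frame: `aW ≤ qq`, `bL ≤ P + W`)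
    {aW Bx bL : ℤ} (ha : D * (c₁' * (n : ℤ) * (b₀ 0 + 1) + c₀' * |vα| * (b₀ 1 + 1)) ≤ c₀' * c₁' * A * modulus n hs vα vβ * aW)
    (hBx : D * ((b₀ 1 : ℤ) + 1) ≤ c₁' * A * Bx) (hbL : Bx / (shearUnit n hs : ℤ) + 1 ≤ bL)
    (haq : aW ≤ qq) (hbW : bL ≤ ((n * ℓ / shearUnit n hs + 1 + W : ℕ) : ℤ))
    -- DEPTH ROW: the frame origin's depth and the prism box inside the window
    {D₀ : ℕ} (hc₀ : c₀ ∈ graphBall G w₀ D₀)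
    (hRD : (D₀ : ℤ) + (kq + 3) * (((N : ℤ) + 1) * n + kgZ₀ n v R' ρ qq N m₁ m₂ + kgZ₁ n ℓ hs R' ρ W N m₁ Wm₂ Wp₂ m₂) ≤ R)
    -- THE RIM EXCESS DEVICE: world rows, excess radius (stmt's)
    {φe : V → Site 2} {Rw m' m R₁ : ℕ} {ctr : Site 2}
    (hWπ : ∀ b ∈ (cellGeomSG₂bT G ψ P w₀ Λ b₀).Ewv ((⟨cellGeomSG₂bT G ψ P w₀ Λ b₀, q, δc⟩ : KSchA V ℕ).aOf₁O G h e) e.1 e.2 ∪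
      (faceDataSGT G ψ P w₀ Λ).Hfull ((⟨cellGeomSG₂bT G ψ P w₀ Λ b₀, q, δc⟩ : KSchA V ℕ).aOf₂O G h e) (tgt e) du, b ∈ graphBall G w₀ Rw)
    (hWpl : ∀ b ∈ (cellGeomSG₂bT G ψ P w₀ Λ b₀).Ewv ((⟨cellGeomSG₂bT G ψ P w₀ Λ b₀, q, δc⟩ : KSchA V ℕ).aOf₁O G h e) e.1 e.2 ∪
      (faceDataSGT G ψ P w₀ Λ).Hfull ((⟨cellGeomSG₂bT G ψ P w₀ Λ b₀, q, δc⟩ : KSchA V ℕ).aOf₂O G h e) (tgt e) du,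
        φe b ∈ (box 2 m').image (fun s => s + ctr))
    (hm : 2 * m' ≤ m)
    (hR₁ : ∀ R'', R₁ ≤ R'' → ∀ (Rw' : ℕ) (D' A' : Finset V), (∀ d ∈ D', d ∈ graphBall G w₀ Rw') →
      (∀ d ∈ D', ∀ d' ∈ D', φe d - φe d' ∈ box 2 m) → A' ⊆ D' → (∀ a ∈ A', a ∈ graphBall G w₀ (R₀ + 1)) →
        (bondPercolation G q).real (excess G w₀ R'' D' A') ≤ η)
    (hR₁R : R₁ ≤ R - Pk.r₀)
    -- THE LONG LINKS AT EVERY CENTRE at accuracy `δ³`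
    (hlong : ∀ c (τ : ℤ), τ = 1 ∨ τ = -1 → 1 - δ ^ 3 < (bondPercolation G q).real
      (linkIn (pgramPrism G φ c n hs (3 * ℓ) Rl) (Λc c kz) (pgSideHalfW G φ c n hs ℓ Rl 1 (1 * τ))))
    (hlongY : ∀ c (τ : ℤ), τ = 1 ∨ τ = -1 → 1 - δ ^ 3 < (bondPercolation G q).real
      (linkIn (pgramPrism G φ c n hs (3 * ℓ) Rl) (Λc c kz) (pgTopPieceW G φ c n hs ℓ Rl 1 τ v)))
    -- the budget
    {nmax : ℕ} (hnmax : (kgCorrSched hP₁ hP₂ hsplit).N ≤ nmax) :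
    Skel.ReachOblAtHNF G nmax (⟨cellGeomSG₂bT G ψ P w₀ Λ b₀, q, δc⟩ : KSchA V ℕ) (faceDataSGT G ψ P w₀ Λ) Δ' δ h e
      ((⟨cellGeomSG₂bT G ψ P w₀ Λ b₀, q, δc⟩ : KSchA V ℕ).aOf₂O G h e) du := by
  set S : KSchA V ℕ := ⟨cellGeomSG₂bT G ψ P w₀ Λ b₀, q, δc⟩ with hSdef
  set α := S.aOf₁O G h e with hα
  set a' := S.aOf₂O G h e with ha'def
  have ha' : a' ∈ S.Γ.anchSet α (tgt e) := hV.anch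
  have hQ : QSepGeom G S.Γ := qSepGeomSG₂bT (P := P) (w₀ := w₀) (Λ := Λ) (b₀ := b₀) hlip
  have hsg : sgOf du = 1 := by
    have h2 : du.2 = true := ((KSchA.mem_onwardO G S).1 hdu).2
    unfold sgOf; rw [h2]; rfl
  have hA0 : 0 ≤ A := hAp.le
  have hm0 : 0 ≤ modulus n hs vα vβ := hmp.le
  have hctr' : fineSkel φ t₀ A n hs vα vβ c₀' c₁' s₀ s₁ D c₀ = PCells2T.cenS P (tgt e) := by rw [← hψ]; exact hctr
  set Sc := kgCorrSched hP₁ hP₂ hsplit with hSc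
  -- the prism lies in the prism box
  have hbox : ∀ u : V, runX φ c₀ n hs 1 u ∈ Sc.prism → runX φ c₀ n hs 1 u ∈ Finset.Icc (![-kgZ₀ n v R' ρ qq N m₁ m₂, -kgZ₁ n ℓ hs R' ρ W N m₁ Wm₂ Wp₂ m₂])
      (![((N : ℤ) + 1) * n + kgZ₀ n v R' ρ qq N m₁ m₂, kgZ₁ n ℓ hs R' ρ W N m₁ Wm₂ Wp₂ m₂]) := by
    intro u hu
    obtain ⟨h1, h2, h3, h4⟩ := mem_kgCorrSched_prism_box hP₁ hP₂ hsplit hu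
    rw [Finset.mem_Icc, Pi.le_def, Pi.le_def, Fin.forall_fin_two, Fin.forall_fin_two]
    simp only [Matrix.cons_val_zero, Matrix.cons_val_one]
    exact ⟨⟨h1, h3⟩, h2, h4⟩
  -- hΩball
  have hΩball : ∀ u ∈ graphBall G w₀ R, runX φ c₀ n hs 1 u ∈ Sc.prism → u ∈ S.Γ.Ewv α e.1 e.2 ∪ (faceDataSGT G ψ P w₀ Λ).Hfull a' (tgt e) du := by
    intro u huR hu
    obtain ⟨h1, h2, h3, h4⟩ := margins_of_rdT (φ := φ) (s₀ := s₀) (s₁ := s₁) (y := tgt e) hA0 hn hm0 hc₀p.le hc₁p.le hDp hctr' hsg hPl hPt (hbox u hu)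
    rw [← hψ] at h1 h2 h3 h4
    exact mem_habΩT_of_footprint hlip hws huR hDQ hDρ' h1 h2 h3 h4
  -- hreg
  have hreg : ∀ k ≤ Sc.N, ∀ u ∈ S.Γ.Ewv α e.1 e.2 ∪ (faceDataSGT G ψ P w₀ Λ).Hfull a' (tgt e) du,
      runX φ c₀ n hs 1 u ∈ Sc.region k → u ∈ S.Γ.Q α (tgt e) ∪ S.Γ.Efar a' (tgt e) du := by
    intro k hk u hu hureg
    have hψu := room_Q_union_Hfull_of_rdT (φ := φ) (s₀ := s₀) (s₁ := s₁) (y := tgt e) hA0 hn hm0 hc₀p.le hc₁p.le hDp hctr' hsg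
      ⟨by linarith [hPl.1], by linarith [hPl.2]⟩ ⟨by linarith [hPt.1], by linarith [hPt.2]⟩ (hbox u (kgCorrSched_region_subset_prism hP₁ hP₂ hsplit hk hureg))
    rw [← hψ] at hψu
    exact mem_Q_union_Efar_of_mem_habΩT hSt ha' hdu' hu hψu
  -- hM0: the source cube read back into the start box
  have hM0 : ∀ u ∈ S.Γ.M α (tgt e), runX φ c₀ n hs 1 u ∈ ScheduleNP.core Sc 0 := by
    intro u hu
    obtain ⟨hψu, -⟩ := footprint_mem_of_mem_MbT (P := P) (w₀ := w₀) (Λ := Λ) (b₀ := b₀) hu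
    rw [PCells2T.mem_Mb_iff] at hψu
    have h0 : |fineSkel φ t₀ A n hs vα vβ c₀' c₁' s₀ s₁ D u 0 - fineSkel φ t₀ A n hs vα vβ c₀' c₁' s₀ s₁ D c₀ 0| ≤ b₀ 0 := by
      rw [← hψ, hctr]; have := hψu 0; exact abs_le.2 ⟨by linarith [this.1], by linarith [this.2]⟩
    have h1 : |fineSkel φ t₀ A n hs vα vβ c₀' c₁' s₀ s₁ D u 1 - fineSkel φ t₀ A n hs vα vβ c₀' c₁' s₀ s₁ D c₀ 1| ≤ b₀ 1 := by
      rw [← hψ, hctr]; have := hψu 1; exact abs_le.2 ⟨by linarith [this.1], by linarith [this.2]⟩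
    have hb' := runX_mem_Icc_of_fine (s₀ := s₀) (s₁ := s₁) hAp hn hmp hc₀p hc₁p hDp t₀ c₀ u (Or.inl rfl) h0 h1 ha hBx hbL
    rw [mem_kgCorrSched_core_zero]
    rw [Finset.mem_Icc, Pi.le_def, Pi.le_def, Fin.forall_fin_two, Fin.forall_fin_two] at hb'
    simp only [Pi.neg_apply, Matrix.cons_val_zero, Matrix.cons_val_one] at hb'
    exact ⟨⟨by linarith [hb'.1.1], by linarith [hb'.2.1]⟩, by linarith [hb'.1.2], by linarith [hb'.2.2]⟩
  -- hlastM: the arrival box read into the target cube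
  have hlastM : ∀ u ∈ S.Γ.Ewv α e.1 e.2 ∪ (faceDataSGT G ψ P w₀ Λ).Hfull a' (tgt e) du,
      runX φ c₀ n hs 1 u ∈ ScheduleNP.core Sc (Sc.N + 1) → u ∈ S.Γ.M a' (tgt e + stepVec du) := by
    intro u hu hlastu
    obtain ⟨hH, hIcc⟩ := room_lastT_of_rd (φ := φ) (s₀ := s₀) (s₁ := s₁) (y := tgt e) hA0 hn hm0 hc₀p.le hc₁p.le hDp hctr' hsg hLl hLt (hlast hlastu)
    rw [← hψ] at hH hIcc
    exact mem_Mb_of_mem_habΩT hlip hdu' hρM hb hu hH hIcc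
  -- the depth row
  have hRdepth : ∀ z ∈ Sc.prism, D₀ + (kq + 3) * ((z 0).natAbs + (z 1).natAbs) ≤ R := by
    intro z hz
    have h := natAbs_le_of_mem_kgCorrSched_prism hP₁ hP₂ hsplit hz
    have h2 : ((kq : ℤ) + 3) * (((z 0).natAbs : ℤ) + (z 1).natAbs) ≤
        ((kq : ℤ) + 3) * (((N : ℤ) + 1) * n + kgZ₀ n v R' ρ qq N m₁ m₂ + kgZ₁ n ℓ hs R' ρ W N m₁ Wm₂ Wp₂ m₂) :=
      mul_le_mul_of_nonneg_left h (by positivity)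
    have : (D₀ : ℤ) + (kq + 3) * (((z 0).natAbs : ℤ) + (z 1).natAbs) ≤ R := by linarith
    exact_mod_cast this
  exact reachOblAtHNF_of_kgCorrEC hL hQ hSt hEx hV ha' hdu hlipφ hstep hΔ hn c₀ (Or.inl rfl) hκL hP₁ hP₂ hsplit hr hrR Pk hPN hA hdD hDρ hKCmax
    hT hr₀ hR hr₀1 hrs hcS hreach Rg hRg hRgcard hcU1 Λc kz hΛRg hzconn hcz hj0 hj hRl hE hδ hη kk hN hk hcount hΩball hreg hM0 hlastM hc₀
    hRdepth hWπ hWpl hdeep hm hR₁ hR₁R (fun c τ hτ => by simpa using hlong c τ hτ) hlongY hnmax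

end Skelφ

end Transplant

end Summit.CriticalPhenomena.PercolationContinuityZ3.Theorems

end
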